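import Summits.KontsevichZagierPeriods.KontsevichZagierPeriods.Theorems.HeckeMultiplicityOneManinStokesGreenPunctured
import Summits.KontsevichZagierPeriods.KontsevichZagierPeriods.Theorems.HeckeMultiplicityOneManinStokesHalfPlaneGreenAux

/-!
# `ManinStokes` (stmt-KontsevichZagierPeriods-5277): Green's theorem for `re (G du)` on the lower half plane
# inside the KZ calculus

Support file (prover-owned, `--supports stmt-KontsevichZagierPeriods-5277`; generic). `green_re_halfPlane`: for `G`
continuous on the closed lower half plane off `{0, 1728}`, holomorphic on the open lower half plane, decaying at
infinity, with `re G`, `im G` `ℚ`-semialgebraic and `G'` absolutely integrable on the open lower half plane, the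
representation `[(−1,1) ∖ {0, x⁻¹(1728)}, re G(x(t)) x'(t)]` lies in `KZ.relations` (value `∫_ℝ re G = 0`,
Cauchy): `green_punctured` on the rectangle `(−1,1) × [0,1]` of `…HalfPlaneMap.lean` with the primitives `A`, `B`,
the common bulk integrand `−im G' y' x'` (Cauchy–Riemann), exceptional vertical fibres over `t ∈ {0, x⁻¹(1728)}`
(ending at the singular boundary points) and horizontal fibre `s = 0` removed; the three edges at infinity carry
the zero integrand.

References: M. Kontsevich, D. Zagier, *Periods* (2001), §1.2 rule (3). No definitions, no named facts.
-/

noncomputable section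

open Set MeasureTheory Filter Topology
open Literature.NumberTheory.Transcendental Literature.ModelTheory.ExponentialFields

namespace Summit.KontsevichZagierPeriods.HeckeMultiplicityOne.ManinStokes

section NullSets

/-- A coordinate hyperplane of `ℝ²` is null. [folklore] -/
theorem volume_setOf_apply_eq (i : Fin 2) (c : ℝ) : volume {w : Fin 2 → ℝ | w i = c} = 0 := by
  rw [MeasureTheory.volume_pi]
  exact Measure.pi_hyperplane (fun _ : Fin 2 => (volume : Measure ℝ)) i c

/-- The real solutions of `1728 (1 − t²) = t` are the two numbers `(−1 ± √(1 + 4·1728²))/3456`. [folklore] -/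
theorem root_cases {t : ℝ} (h : 1728 * (1 - t ^ 2) = t) :
    t = (-1 + Real.sqrt (1 + 4 * 1728 ^ 2)) / 3456 ∨ t = (-1 - Real.sqrt (1 + 4 * 1728 ^ 2)) / 3456 := by
  have hq : 1728 * (t * t) + 1 * t + (-1728) = 0 := by nlinarith
  have hdisc : discrim (1728 : ℝ) 1 (-1728) = Real.sqrt (1 + 4 * 1728 ^ 2) * Real.sqrt (1 + 4 * 1728 ^ 2) := by
    rw [discrim, ← pow_two, Real.sq_sqrt (by positivity)]; ring
  have := (quadratic_eq_zero_iff (by norm_num : (1728 : ℝ) ≠ 0) hdisc t).mp hq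
  rcases this with h1 | h1
  · left; rw [h1]; ring
  · right; rw [h1]; ring

/-- The exceptional `t`-lines are null. [folklore] -/
theorem volume_setOf_root_eq_zero (i : Fin 2) :
    volume {w : Fin 2 → ℝ | 1728 * (1 - w i ^ 2) = w i} = 0 := by
  refine measure_mono_null (fun w hw => ?_)
    (measure_union_null (volume_setOf_apply_eq i ((-1 + Real.sqrt (1 + 4 * 1728 ^ 2)) / 3456))
      (volume_setOf_apply_eq i ((-1 - Real.sqrt (1 + 4 * 1728 ^ 2)) / 3456)))
  rcases root_cases (t := w i) hw with h | h
  · exact Or.inl h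
  · exact Or.inr h

end NullSets

section GreenTheorem

variable {x y xd yd : ℝ → ℝ} {G : ℂ → ℂ}

/-- The open band over a `ℚ`-semialgebraic base of `ℝ¹` with integer edges is `ℚ`-semialgebraic. [folklore] -/
theorem isSemialgebraic_openBand {τ : Set (Fin 1 → ℝ)} (hτ : IsSemialgebraic ℚ τ) (a b : ℤ) :
    IsSemialgebraic ℚ {z : Fin 2 → ℝ | Fin.init z ∈ τ ∧ (a : ℝ) < z (Fin.last 1) ∧ z (Fin.last 1) < b} := by
  have h1 : IsSemialgebraic ℚ {z : Fin 2 → ℝ | Fin.init z ∈ τ} := hτ.setOf_init_mem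
  have h2 := isSemialgebraic_setOf_eval_pos (k := ℚ) (R := ℝ) (MvPolynomial.X (1 : Fin 2) - MvPolynomial.C (a : ℚ) : MvPolynomial (Fin 2) ℚ)
  have h3 := isSemialgebraic_setOf_eval_pos (k := ℚ) (R := ℝ) (MvPolynomial.C (b : ℚ) - MvPolynomial.X (1 : Fin 2) : MvPolynomial (Fin 2) ℚ)
  have he : {z : Fin 2 → ℝ | Fin.init z ∈ τ ∧ (a : ℝ) < z (Fin.last 1) ∧ z (Fin.last 1) < b} =
      {z : Fin 2 → ℝ | Fin.init z ∈ τ} ∩ ({z | 0 < MvPolynomial.aeval z (MvPolynomial.X (1 : Fin 2) - MvPolynomial.C (a : ℚ) : MvPolynomial (Fin 2) ℚ)} ∩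
        {z | 0 < MvPolynomial.aeval z (MvPolynomial.C (b : ℚ) - MvPolynomial.X (1 : Fin 2) : MvPolynomial (Fin 2) ℚ)}) := by
    ext z
    simp only [mem_setOf_eq, mem_inter_iff, map_sub, MvPolynomial.aeval_X, MvPolynomial.aeval_C, eq_ratCast,
      Rat.cast_intCast, sub_pos, show (Fin.last 1 : Fin 2) = 1 from rfl]
  rw [he]
  exact h1.inter (h2.inter h3)

/-- **Green's theorem for `re (G du)` on the lower half plane, inside the KZ calculus.** Let `G` be
continuous on the closed lower half plane off `{0, 1728}`, holomorphic on the open lower half plane,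
decaying at infinity, with `re G`, `im G` `ℚ`-semialgebraic (as functions of `(re u, im u)`) and `G'`
absolutely integrable on the open lower half plane. Then, with `x(t) = t/(1 − t²)`, the representation
`[(−1,1) ∖ {0, x⁻¹(1728)}, re G(x(t)) · x'(t)]` — the bottom edge of the compactifying rectangle
`(−1,1) × [0,1]`, `u = x(t) + i y(s)`, `y(s) = −s/(1 − s)` — lies in `KZ.relations`: `green_punctured`
applied with the vertical primitive `A(t,s) = re G(x(t) + iy(s)) x'(t)` (`0` on the edge at infinity
`s = 1`), the horizontal primitive `B(s,t) = −im G(x(t) + iy(s)) y'(s)` (`0` at `t = ±1`), and the common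
bulk integrand `−im G'(u) y'(s) x'(t)` (Cauchy–Riemann); the three other edges carry the zero integrand.
Value: `∫_ℝ re G(u) du = 0` (Cauchy's theorem). [cite: KontsevichZagierPeriods2001, §1.2 rule (3)] -/
theorem green_re_halfPlane (hx : ∀ t, x t = t / (1 - t ^ 2)) (hxd : ∀ t, xd t = (1 + t ^ 2) / (1 - t ^ 2) ^ 2)
    (hy : ∀ s, y s = -s / (1 - s)) (hyd : ∀ s, yd s = -1 / (1 - s) ^ 2)
    (hGc : ContinuousOn G {u : ℂ | u.im ≤ 0 ∧ u ≠ 0 ∧ u ≠ 1728})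
    (hGd : DifferentiableOn ℂ G {u : ℂ | u.im < 0})
    (hGdecay : ∀ ε > 0, ∃ R, ∀ u : ℂ, u.im ≤ 0 → R ≤ ‖u‖ → ‖G u‖ ≤ ε)
    (hGre : IsSemialgebraicFunOn ℚ {w : Fin 2 → ℝ | w 1 ≤ 0 ∧ ¬(w 0 = 0 ∧ w 1 = 0) ∧ ¬(w 0 = 1728 ∧ w 1 = 0)}
      (fun w => (G ((w 0 : ℂ) + (w 1 : ℂ) * Complex.I)).re))
    (hGim : IsSemialgebraicFunOn ℚ {w : Fin 2 → ℝ | w 1 ≤ 0 ∧ ¬(w 0 = 0 ∧ w 1 = 0) ∧ ¬(w 0 = 1728 ∧ w 1 = 0)}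
      (fun w => (G ((w 0 : ℂ) + (w 1 : ℂ) * Complex.I)).im))
    (hGint : IntegrableOn (fun w : Fin 2 → ℝ => deriv G ((w 0 : ℂ) + (w 1 : ℂ) * Complex.I)) {w | w 1 < 0})
    (rB : KZ.IntegralRep 1)
    (hrB : rB.domain = {t : Fin 1 → ℝ | t 0 ∈ Ioo (-1 : ℝ) 1 ∧ t 0 ≠ 0 ∧ 1728 * (1 - t 0 ^ 2) ≠ t 0})
    (hrBi : ∀ t ∈ {t : Fin 1 → ℝ | t 0 ∈ Ioo (-1 : ℝ) 1 ∧ t 0 ≠ 0 ∧ 1728 * (1 - t 0 ^ 2) ≠ t 0},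
      rB.integrand t = (G (x (t 0))).re * xd (t 0)) :
    KZ.of rB ∈ KZ.relations := by
  classical
  set τv := {t : Fin 1 → ℝ | t 0 ∈ Ioo (-1 : ℝ) 1 ∧ t 0 ≠ 0 ∧ 1728 * (1 - t 0 ^ 2) ≠ t 0} with hτv
  set τh := {s : Fin 1 → ℝ | s 0 ∈ Ioo (0 : ℝ) 1} with hτh
  have hτvs : IsSemialgebraic ℚ τv := isSemialgebraic_baseV
  have hτhs : IsSemialgebraic ℚ τh := isSemialgebraic_baseH
  -- the primitives and the bulk integrand
  set A : (Fin 2 → ℝ) → ℝ := fun w =>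
    if w 1 < 1 then (G ((x (w 0) : ℂ) + (y (w 1) : ℂ) * Complex.I)).re * xd (w 0) else 0 with hAdef
  have hA : ∀ w, A w = if w 1 < 1 then (G ((x (w 0) : ℂ) + (y (w 1) : ℂ) * Complex.I)).re * xd (w 0) else 0 :=
    fun w => rfl
  set B : (Fin 2 → ℝ) → ℝ := fun w =>
    if w 1 ∈ Ioo (-1 : ℝ) 1 then -(G ((x (w 1) : ℂ) + (y (w 0) : ℂ) * Complex.I)).im * yd (w 0) else 0 with hBdef
  have hB : ∀ w, B w = if w 1 ∈ Ioo (-1 : ℝ) 1 then -(G ((x (w 1) : ℂ) + (y (w 0) : ℂ) * Complex.I)).im * yd (w 0) else 0 :=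
    fun w => rfl
  set gf : (Fin 2 → ℝ) → ℝ := fun w =>
    -(deriv G ((x (w 0) : ℂ) + (y (w 1) : ℂ) * Complex.I)).im * yd (w 1) * xd (w 0) with hgfdef
  have hgf : ∀ w, gf w = -(deriv G ((x (w 0) : ℂ) + (y (w 1) : ℂ) * Complex.I)).im * yd (w 1) * xd (w 0) :=
    fun w => rfl
  set gv : (Fin 2 → ℝ) → ℝ := fun w => if (w 0 ∈ Ioo (-1 : ℝ) 1 ∧ w 1 ∈ Ioo (0 : ℝ) 1) then gf w else 0 with hgvdef
  set gh : (Fin 2 → ℝ) → ℝ := fun w => gv (fun l => w (Equiv.swap (0 : Fin 2) 1 l)) with hghdef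
  -- constants as edge functions
  have ha : IsSemialgebraicFunOn ℚ τv (fun _ => (0 : ℝ)) :=
    isSemialgebraicFunOn_const_int hτvs 0 |>.congr fun _ _ => by simp
  have hb : IsSemialgebraicFunOn ℚ τv (fun _ => (1 : ℝ)) :=
    isSemialgebraicFunOn_const_int hτvs 1 |>.congr fun _ _ => by simp
  have hc : IsSemialgebraicFunOn ℚ τh (fun _ => (-1 : ℝ)) :=
    isSemialgebraicFunOn_const_int hτhs (-1) |>.congr fun _ _ => by simp
  have hd : IsSemialgebraicFunOn ℚ τh (fun _ => (1 : ℝ)) :=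
    isSemialgebraicFunOn_const_int hτhs 1 |>.congr fun _ _ => by simp
  -- the common set `W'` (in the horizontal coordinates `(s, t)`)
  set W' : Set (Fin 2 → ℝ) := {w | w 0 ∈ Ioo (0 : ℝ) 1 ∧ w 1 ∈ Ioo (-1 : ℝ) 1 ∧ w 1 ≠ 0 ∧ 1728 * (1 - w 1 ^ 2) ≠ w 1}
    with hW'def
  have hW's : IsSemialgebraic ℚ W' := by
    have h1 : IsSemialgebraic ℚ {w : Fin 2 → ℝ | Fin.init w ∈ τh} := hτhs.setOf_init_mem
    have h2 : IsSemialgebraic ℚ {w : Fin 2 → ℝ | (fun i => w (Equiv.swap (0 : Fin 2) 1 i)) ∈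
        {v : Fin 2 → ℝ | Fin.init v ∈ τv}} := hτvs.setOf_init_mem.preimage_comp (Equiv.swap (0 : Fin 2) 1)
    have he : W' = {w : Fin 2 → ℝ | Fin.init w ∈ τh} ∩ {w : Fin 2 → ℝ | (fun i => w (Equiv.swap (0 : Fin 2) 1 i)) ∈
        {v : Fin 2 → ℝ | Fin.init v ∈ τv}} := by
      ext w
      simp only [hW'def, hτh, hτv, mem_setOf_eq, mem_inter_iff, Equiv.swap_apply_left, Fin.init,
        Fin.castSucc_zero]
    rw [he]; exact h1.inter h2
  have hW'v : W' ⊆ {w : Fin 2 → ℝ | (fun i => w (Equiv.swap (0 : Fin 2) 1 i)) ∈ KZlog.band τv (fun _ => 0) (fun _ => 1)} := by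
    rintro w ⟨h0, h1, h2, h3⟩
    refine ⟨?_, ?_, ?_⟩
    · show (fun i => w (Equiv.swap (0 : Fin 2) 1 i)) (Fin.castSucc 0) ∈ Ioo (-1 : ℝ) 1 ∧ _ ∧ _
      simpa using ⟨h1, h2, h3⟩
    · show (0 : ℝ) ≤ w (Equiv.swap (0 : Fin 2) 1 (Fin.last 1))
      simpa using h0.1.le
    · show w (Equiv.swap (0 : Fin 2) 1 (Fin.last 1)) ≤ 1
      simpa using h0.2.le
  have hW'h : W' ⊆ KZlog.band τh (fun _ => -1) (fun _ => 1) := by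
    rintro w ⟨h0, h1, _, _⟩
    exact ⟨show (Fin.init w : Fin 1 → ℝ) 0 ∈ Ioo (0 : ℝ) 1 by simpa [init_apply_zero] using h0,
      show (-1 : ℝ) ≤ w (Fin.last 1) by simpa using h1.1.le, show w (Fin.last 1) ≤ 1 by simpa using h1.2.le⟩
  -- null differences
  have hvolv : volume ({w : Fin 2 → ℝ | (fun i => w (Equiv.swap (0 : Fin 2) 1 i)) ∈
      KZlog.band τv (fun _ => 0) (fun _ => 1)} \ W') = 0 := by
    refine measure_mono_null (fun w hw => ?_) (measure_union_null (volume_setOf_apply_eq 0 0) (volume_setOf_apply_eq 0 1))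
    obtain ⟨⟨hτ, h0, h1⟩, hW⟩ := hw
    have hτ' : w 1 ∈ Ioo (-1 : ℝ) 1 ∧ w 1 ≠ 0 ∧ 1728 * (1 - w 1 ^ 2) ≠ w 1 := by
      simpa [hτv, Fin.init] using hτ
    have h0' : (0 : ℝ) ≤ w 0 := by simpa using h0
    have h1' : w 0 ≤ 1 := by simpa using h1
    have hno : ¬ (w 0 ∈ Ioo (0 : ℝ) 1) := fun hc' => hW ⟨hc', hτ'.1, hτ'.2.1, hτ'.2.2⟩
    rcases h0'.eq_or_lt with h | h
    · exact Or.inl h.symm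
    · rcases h1'.lt_or_eq with h' | h'
      · exact absurd ⟨h, h'⟩ hno
      · exact Or.inr h'
  have hvolh : volume (KZlog.band τh (fun _ => -1) (fun _ => 1) \ W') = 0 := by
    refine measure_mono_null (fun w hw => ?_) (measure_union_null (measure_union_null
      (measure_union_null (volume_setOf_apply_eq 1 (-1)) (volume_setOf_apply_eq 1 1)) (volume_setOf_apply_eq 1 0))
      (volume_setOf_root_eq_zero 1))
    obtain ⟨⟨hτ, h0, h1⟩, hW⟩ := hw
    have hτ' : w 0 ∈ Ioo (0 : ℝ) 1 := by simpa [hτh, init_apply_zero] using hτ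
    have h0' : (-1 : ℝ) ≤ w 1 := by simpa using h0
    have h1' : w 1 ≤ 1 := by simpa using h1
    simp only [mem_union, mem_setOf_eq]
    by_contra hcon
    simp only [not_or] at hcon
    obtain ⟨⟨⟨hm1, hp1⟩, hz⟩, hr⟩ := hcon
    exact hW ⟨hτ', ⟨h0'.lt_of_ne (Ne.symm hm1), h1'.lt_of_ne hp1⟩, hz, hr⟩
  -- integrability of the bulk integrands
  have hgf_int : IntegrableOn gf {w : Fin 2 → ℝ | w 0 ∈ Ioo (-1 : ℝ) 1 ∧ w 1 ∈ Ioo (0 : ℝ) 1} :=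
    integrableOn_green_integrand hx hxd hy hyd hGd hGint hgf
  have hgv_ind : gv = {w : Fin 2 → ℝ | w 0 ∈ Ioo (-1 : ℝ) 1 ∧ w 1 ∈ Ioo (0 : ℝ) 1}.indicator gf := by
    funext w
    by_cases h : (w 0 ∈ Ioo (-1 : ℝ) 1 ∧ w 1 ∈ Ioo (0 : ℝ) 1)
    · rw [Set.indicator_of_mem (show w ∈ {w : Fin 2 → ℝ | w 0 ∈ Ioo (-1 : ℝ) 1 ∧ w 1 ∈ Ioo (0 : ℝ) 1} from h)]
      exact if_pos h
    · rw [Set.indicator_of_notMem (show w ∉ {w : Fin 2 → ℝ | w 0 ∈ Ioo (-1 : ℝ) 1 ∧ w 1 ∈ Ioo (0 : ℝ) 1} from h)]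
      exact if_neg h
  have hgv_int : Integrable gv := by
    rw [hgv_ind]
    exact (integrable_indicator_iff measurableSet_rect).mpr hgf_int
  have hgh_int : Integrable gh := by
    have hmp : MeasurePreserving (MeasurableEquiv.piCongrLeft (fun _ : Fin 2 => ℝ) (Equiv.swap (0 : Fin 2) 1))
        (volume : Measure (Fin 2 → ℝ)) (volume : Measure (Fin 2 → ℝ)) :=
      volume_measurePreserving_piCongrLeft (fun _ : Fin 2 => ℝ) (Equiv.swap (0 : Fin 2) 1)
    have happ : ∀ w : Fin 2 → ℝ, MeasurableEquiv.piCongrLeft (fun _ : Fin 2 => ℝ) (Equiv.swap (0 : Fin 2) 1) w =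
        fun i => w (Equiv.swap (0 : Fin 2) 1 i) := by
      intro w; ext i
      have h := MeasurableEquiv.piCongrLeft_apply_apply (Equiv.swap (0 : Fin 2) 1) (β := fun _ : Fin 2 => ℝ) w
        ((Equiv.swap (0 : Fin 2) 1) i)
      rw [Equiv.swap_apply_self] at h
      rw [h]
    have h := (hmp.integrable_comp_emb (MeasurableEquiv.piCongrLeft (fun _ : Fin 2 => ℝ)
      (Equiv.swap (0 : Fin 2) 1)).measurableEmbedding).mpr hgv_int
    have hfun : gh = gv ∘ (MeasurableEquiv.piCongrLeft (fun _ : Fin 2 => ℝ) (Equiv.swap (0 : Fin 2) 1)) := by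
      funext w; rw [Function.comp_apply, happ]
    rw [hfun]; exact h
  -- the primitives: semialgebraic, continuous on closed fibres, differentiable on open fibres
  have hP := isSemialgebraicFunOn_verticalPrimitive hx hxd hy hGre hA
  have hQ := isSemialgebraicFunOn_horizontalPrimitive hx hy hyd hGim hB
  have hPc : ∀ t ∈ τv, ContinuousOn (fun s : ℝ => A (Fin.snoc t s)) (Icc ((fun _ : Fin 1 → ℝ => (0 : ℝ)) t)
      ((fun _ : Fin 1 → ℝ => (1 : ℝ)) t)) := fun t ht =>
    continuousOn_vertical_primitive hx hy hGc hGdecay hA t ht.1 ht.2.1 ht.2.2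
  have hQc : ∀ s ∈ τh, ContinuousOn (fun t : ℝ => B (Fin.snoc s t)) (Icc ((fun _ : Fin 1 → ℝ => (-1 : ℝ)) s)
      ((fun _ : Fin 1 → ℝ => (1 : ℝ)) s)) := fun s hs =>
    continuousOn_horizontal_primitive hx hy hGc hGdecay hB s hs
  have hPd : ∀ t ∈ τv, ∀ s ∈ Ioo ((fun _ : Fin 1 → ℝ => (0 : ℝ)) t) ((fun _ : Fin 1 → ℝ => (1 : ℝ)) t),
      HasDerivAt (fun s' : ℝ => A (Fin.snoc t s')) (gv (Fin.snoc t s)) s := by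
    intro t ht s hs
    have hgvs : gv (Fin.snoc t s) = gf (Fin.snoc t s) := by
      show (if _ then _ else _) = _
      rw [if_pos]
      rw [snoc_zero, snoc_one]; exact ⟨ht.1, hs⟩
    rw [hgvs]
    exact hasDerivAt_verticalPrimitive hy hyd hGd hA hgf t hs
  have hQd : ∀ s ∈ τh, ∀ t ∈ Ioo ((fun _ : Fin 1 → ℝ => (-1 : ℝ)) s) ((fun _ : Fin 1 → ℝ => (1 : ℝ)) s),
      HasDerivAt (fun t' : ℝ => B (Fin.snoc s t')) (gh (Fin.snoc s t)) t := by
    intro s hs t ht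
    have hghs : gh (Fin.snoc s t) = gf (fun l => (Fin.snoc s t : Fin 2 → ℝ) (Equiv.swap (0 : Fin 2) 1 l)) := by
      show (if _ then _ else _) = _
      rw [if_pos]
      simp only [Equiv.swap_apply_left, Equiv.swap_apply_right, snoc_one, snoc_zero]
      exact ⟨ht, hs⟩
    rw [hghs]
    exact hasDerivAt_horizontalPrimitive hx hxd hy hGd hB hgf s hs ht
  -- the bulk integrands are semialgebraic on the closed bands
  have hOVs : IsSemialgebraic ℚ {z : Fin 2 → ℝ | Fin.init z ∈ τv ∧ (0 : ℝ) < z (Fin.last 1) ∧ z (Fin.last 1) < 1} := by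
    simpa using isSemialgebraic_openBand hτvs 0 1
  have hOHs : IsSemialgebraic ℚ {z : Fin 2 → ℝ | Fin.init z ∈ τh ∧ (-1 : ℝ) < z (Fin.last 1) ∧ z (Fin.last 1) < 1} := by
    simpa using isSemialgebraic_openBand hτhs (-1) 1
  have hgO : IsSemialgebraicFunOn ℚ {z : Fin 2 → ℝ | Fin.init z ∈ τv ∧ (0 : ℝ) < z (Fin.last 1) ∧ z (Fin.last 1) < 1} gf :=
    IsSemialgebraicFunOn.hasDerivAt_last_isSemialgebraic_holds 1 τv (fun _ => 0) (fun _ => 1) A gf ha hb hP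
      fun t _ s hs => hasDerivAt_verticalPrimitive hy hyd hGd hA hgf t hs
  have hgO' : IsSemialgebraicFunOn ℚ {z : Fin 2 → ℝ | Fin.init z ∈ τh ∧ (-1 : ℝ) < z (Fin.last 1) ∧ z (Fin.last 1) < 1}
      (fun w => gf (fun l => w (Equiv.swap (0 : Fin 2) 1 l))) :=
    IsSemialgebraicFunOn.hasDerivAt_last_isSemialgebraic_holds 1 τh (fun _ => -1) (fun _ => 1) B _ hc hd hQ
      fun s hs t ht => hasDerivAt_horizontalPrimitive hx hxd hy hGd hB hgf s hs ht
  have hband_v : IsSemialgebraic ℚ (KZlog.band τv (fun _ => 0) (fun _ => 1)) := KZlog.isSemialgebraic_band ha hb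
  have hband_h : IsSemialgebraic ℚ (KZlog.band τh (fun _ => -1) (fun _ => 1)) := KZlog.isSemialgebraic_band hc hd
  have hgvS : IsSemialgebraicFunOn ℚ (KZlog.band τv (fun _ => 0) (fun _ => 1)) gv := by
    set OV := {z : Fin 2 → ℝ | Fin.init z ∈ τv ∧ (0 : ℝ) < z (Fin.last 1) ∧ z (Fin.last 1) < 1} with hOV
    have hsub : OV ⊆ KZlog.band τv (fun _ => 0) (fun _ => 1) := fun z hz => ⟨hz.1, hz.2.1.le, hz.2.2.le⟩
    have hz0 : IsSemialgebraicFunOn ℚ (KZlog.band τv (fun _ => 0) (fun _ => 1) \ OV) (fun _ => (0 : ℝ)) :=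
      isSemialgebraicFunOn_const_int (hband_v.diff hOVs) 0 |>.congr fun _ _ => by simp
    rw [← Set.union_sdiff_cancel hsub]
    refine IsSemialgebraicFunOn.union hgO hz0 (fun z hz => ?_) (fun z hz => ?_)
    · show (if _ then _ else _) = _
      rw [if_pos]
      exact ⟨by simpa [hτv, init_apply_zero] using hz.1.1, by simpa using (⟨hz.2.1, hz.2.2⟩ : _ ∧ _)⟩
    · show (if _ then _ else _) = _
      rw [if_neg]
      rintro ⟨_, h1⟩
      exact hz.2 ⟨hz.1.1, by simpa using h1.1, by simpa using h1.2⟩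
  have hghS : IsSemialgebraicFunOn ℚ (KZlog.band τh (fun _ => -1) (fun _ => 1)) gh := by
    set OH := {z : Fin 2 → ℝ | Fin.init z ∈ τh ∧ (-1 : ℝ) < z (Fin.last 1) ∧ z (Fin.last 1) < 1} with hOH
    have hsub : OH ⊆ KZlog.band τh (fun _ => -1) (fun _ => 1) := fun z hz => ⟨hz.1, hz.2.1.le, hz.2.2.le⟩
    have hz0 : IsSemialgebraicFunOn ℚ (KZlog.band τh (fun _ => -1) (fun _ => 1) \ OH) (fun _ => (0 : ℝ)) :=
      isSemialgebraicFunOn_const_int (hband_h.diff hOHs) 0 |>.congr fun _ _ => by simp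
    rw [← Set.union_sdiff_cancel hsub]
    refine IsSemialgebraicFunOn.union hgO' hz0 (fun z hz => ?_) (fun z hz => ?_)
    · show (if _ then _ else _) = _
      rw [if_pos]
      simp only [Equiv.swap_apply_left, Equiv.swap_apply_right]
      exact ⟨by simpa using (⟨hz.2.1, hz.2.2⟩ : _ ∧ _), by simpa [hτh, init_apply_zero] using hz.1⟩
    · show (if _ then _ else _) = _
      rw [if_neg]
      simp only [Equiv.swap_apply_left, Equiv.swap_apply_right]
      rintro ⟨h1, _⟩
      exact hz.2 ⟨hz.1.1, by simpa using h1.1, by simpa using h1.2⟩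
  -- the edge representations: three of them carry the zero integrand
  have h0h : IsSemialgebraicFunOn ℚ τh (fun _ => (0 : ℝ)) :=
    isSemialgebraicFunOn_const_int hτhs 0 |>.congr fun _ _ => by simp
  let rT : KZ.IntegralRep 1 := ⟨τv, fun _ => 0, hτvs, ha, integrableOn_zero⟩
  let rR : KZ.IntegralRep 1 := ⟨τh, fun _ => 0, hτhs, h0h, integrableOn_zero⟩
  let rL : KZ.IntegralRep 1 := ⟨τh, fun _ => 0, hτhs, h0h, integrableOn_zero⟩
  have hTi : ∀ t ∈ τv, rT.integrand t = A (Fin.snoc t 1) := by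
    intro t _
    show (0 : ℝ) = A (Fin.snoc t 1)
    rw [hA, snoc_one]
    simp
  have hBi : ∀ t ∈ τv, rB.integrand t = A (Fin.snoc t 0) := by
    intro t ht
    rw [hrBi t ht, hA, snoc_one, snoc_zero, yMap_zero hy]
    simp
  have hRi : ∀ s ∈ τh, rR.integrand s = B (Fin.snoc s 1) := by
    intro s _
    show (0 : ℝ) = B (Fin.snoc s 1)
    rw [hB, snoc_one, if_neg (fun h => lt_irrefl _ h.2)]
  have hLi : ∀ s ∈ τh, rL.integrand s = B (Fin.snoc s (-1)) := by
    intro s _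
    show (0 : ℝ) = B (Fin.snoc s (-1))
    rw [hB, snoc_one, if_neg (fun h => lt_irrefl _ h.1)]
  have key := green_punctured τv τh (fun _ => 0) (fun _ => 1) (fun _ => -1) (fun _ => 1) ha hb (fun _ _ => zero_le_one)
    hc hd (fun _ _ => by norm_num) W' hW's hW'v hW'h hvolv hvolh gv gh A B hgvS hgv_int.integrableOn hghS
    hgh_int.integrableOn (fun _ _ => rfl) hP hPc hPd hQ hQc hQd rT rB rR rL rfl hrB rfl rfl hTi hBi hRi hLi
  have hT0 : KZ.of rT ∈ KZ.relations := KZ.of_mem_relations_of_eqOn_zero rT fun _ _ => rfl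
  have hR0 : KZ.of rR ∈ KZ.relations := KZ.of_mem_relations_of_eqOn_zero rR fun _ _ => rfl
  have hL0 : KZ.of rL ∈ KZ.relations := KZ.of_mem_relations_of_eqOn_zero rL fun _ _ => rfl
  have h := KZ.relations.sub_mem (KZ.relations.sub_mem hT0 key) (KZ.relations.sub_mem hR0 hL0)
  convert h using 1
  abel

end GreenTheorem

end Summit.KontsevichZagierPeriods.HeckeMultiplicityOne.ManinStokes
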